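import Summits.HodgeConjecture.HodgeConjecture.Theorems.Ring2WeilCoverageNormClassEq
import Summits.HodgeConjecture.HodgeConjecture.Theorems.Ring2WeilNormObstructionDescentCensus
import HarnessLib

/-!
# Weil-type family coverage — THEOREM S6 (product-window law), part B: the `C₃ × A₅`, `C₆ × F₂₀` and `C₄ × S₃` data

research route conditional on HC_CM; not a corollary; Q11.4-sentence-2 already refuted in dim ≥ 3.

Ring 2, WEIL-TYPE FAMILY-COVERAGE CENSUS (`HOME/WEIL-FAMILY-COVERAGE.md` `## b04`, block b04.13, owner ring2-b04, gen 49); second part of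
`Ring2WeilCoverageProductWindow` (same imports as part A, whose module docstring states THEOREM S6: for `G = C_k × G₂`, `G₂` 2-transitive of
degree `n`, the hidden factor `B = (H¹(P)^{Stab}, E|)` of the `(λ⊗ρ)`-piece `P ~ B^{n−1}` has `[a_B] = [n]^{r₁}` when it is of Weil type,
`r₁ = dim_K H¹(C̃/G₂)_λ`).  Literal classes (engine `prodwin.py` = ring2-b02's `qcover.py` + the product-window block, exact; kit
j194942/j194944/j194946/j194947 + local runs) of: the rigid `(1,1)` SURFACES on `W2.3.5` from `C₃ × A₅` `(0; 3,3,5A)` (genus 25) and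
`C₆ × F₂₀` (genus 21); the one-parameter `(2,2)` FOURFOLD family of `C₃ × A₅`-curves of genus 61 and the rigid fourfolds of `C₆ × F₂₀`-curves
(genus 41, 45) on `W4.3.5`; the two one-parameter `(3,3)` SIXFOLD families of `C₆ × F₂₀`-curves (genus 51, 71) on `W6.3.5 = (3, ℚ(√-3), [5])` —
pub-hsemireg's row R2 (`K = ℚ(√-3)` through the `C₆`; the closed form is not claimed for `k = 6`, the class is the engine's and the orthogonal
additivity of S6's Lemma A holds exactly); and the four two-parameter `(3,3)` SIXFOLD families of `C₄ × S₃`-curves (genus 21, 23, 23, 25) on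
`W6.1.3 = (3, ℚ(i), [3])` — pub-hsemireg's row R3 — as the law `[3]^{r₁}` (`r₁ = 3`) predicts.  Each non-split datum carries its CELL
IDENTIFICATION `[det H] = [-5]` / `[5]` / `[-3]` (the census row keys).  No `def`, no named fact, no `sorry`; nothing about Hodge classes;
`HC_CM` used nowhere.  References: [cite: vanGeemen1994HodgeAV, (5.4.1), Lemma 5.2].
-/

set_option linter.dupNamespace false

open Literature.AlgebraicGeometry.Motives
open Literature.AlgebraicGeometry.VanGeemen1994
open Summit.HodgeConjecture.HodgeConjecture.Ring2.Hypotheses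

namespace Summit.HodgeConjecture.HodgeConjecture.Ring2.WeilCoverage

/-- `C₃ × A₅` (on 5 points)-cover `(0; c1:3,c1:3,c1:5A)` (genus 25, Hurwitz dimension 0; engine `prodwin.py`, exact): the HIDDEN FACTOR `B = V^{H₁×Stab(0)}` of the `(λ⊗ρ)`-piece `P ~ B^{4}` (census row of `P`: `W8.3.1`) — an abelian SURFACE with `(1,1)` `ℚ(√-3)`-action, WEIL TYPE — has literal `det H|_B = -64/5`, `a = 64/5`, `T(a) = [3, 5]`: row `W2.3.5` (NON-split); `r₁ = dim_K H¹(C̃/G₂)_λ = 1`. THEOREM S6 (product-window law, census b04.13 (A)) predicts `T(a_B) = [3, 5]` from `r₁ = 1`, `r_H = 3` — CONFIRMED.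
research route conditional on HC_CM; not a corollary; Q11.4-sentence-2 already refuted in dim ≥ 3. [cite: vanGeemen1994HodgeAV, (5.4.1)] -/
theorem pwC3A5_c13_c13_c15A_q0_g25_mk_detH_ne_split :
    (QuotientGroup.mk (Units.mk0 (((-64 : ℚ) / 5)) (by norm_num)) : weilNormResidueGroup 3) ≠
      splitDiscriminantClass 1 3 := by
  have e : Units.mk0 (((-64 : ℚ) / 5)) (by norm_num) = -(Units.mk0 ((64 : ℚ) / 5) (by norm_num)) := Units.ext (by norm_num)
  rw [Ne, e, mk_neg_eq_splitDiscriminantClass_iff_of_odd (n := 1) (by decide)]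
  have h := mul_not_mem_normUnitsSubgroup (mem_normUnitsSubgroup_of_sq_add_mul_sq (d := 3) (a := ((64 : ℚ) / 25)) (by norm_num) ((8 : ℚ) / 5) (0 : ℚ) (by norm_num))
    Summit.HodgeConjecture.Ring2WeilNormDescent.five_not_mem_norm_three
  rw [mk0_mul_mk0] at h
  norm_num at h
  exact h

/-- The same datum, CELL IDENTIFICATION: `[det H|_B] = [-5]` in `ℚˣ/Nm(ℚ(√-3)ˣ)` — the census ROW KEY of `W2.3.5` (`a·5 = (64 : ℚ) = ((8 : ℚ))² + 3·((0 : ℚ))²`).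
research route conditional on HC_CM; not a corollary; Q11.4-sentence-2 already refuted in dim ≥ 3. [cite: vanGeemen1994HodgeAV, Lemma 5.2 (3)] -/
theorem pwC3A5_c13_c13_c15A_q0_g25_mk_detH_eq_key :
    (QuotientGroup.mk (Units.mk0 (-(((64 : ℚ) / 5))) (neg_ne_zero.2 (by norm_num))) : weilNormResidueGroup 3) =
      QuotientGroup.mk (Units.mk0 (-(5 : ℚ)) (neg_ne_zero.2 (by norm_num))) :=
  mk_neg_eq_mk_neg_of_mul_mem (by norm_num) (by norm_num)
    (mem_normUnitsSubgroup_of_sq_add_mul_sq _ (8 : ℚ) (0 : ℚ) (by norm_num))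

/-- `C₃ × A₅` (on 5 points)-cover `(0; c0:22,c1:22,c1:3,c1:3)` (genus 61, Hurwitz dimension 1; engine `prodwin.py`, exact): the HIDDEN FACTOR `B = V^{H₁×Stab(0)}` of the `(λ⊗ρ)`-piece `P ~ B^{4}` (census row of `P`: `W16.3.1`) — an abelian FOURFOLD with `(2,2)` `ℚ(√-3)`-action, WEIL TYPE — has literal `det H|_B = 99328/10935`, `a = 99328/10935`, `T(a) = [3, 5]`: row `W4.3.5` (NON-split); `r₁ = dim_K H¹(C̃/G₂)_λ = 1`. THEOREM S6 (product-window law, census b04.13 (A)) predicts `T(a_B) = [3, 5]` from `r₁ = 1`, `r_H = 5` — CONFIRMED.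
research route conditional on HC_CM; not a corollary; Q11.4-sentence-2 already refuted in dim ≥ 3. [cite: vanGeemen1994HodgeAV, (5.4.1)] -/
theorem pwC3A5_c022_c122_c13_c13_q0_g61_mk_detH_ne_split :
    (QuotientGroup.mk (Units.mk0 (((99328 : ℚ) / 10935)) (by norm_num)) : weilNormResidueGroup 3) ≠
      splitDiscriminantClass 2 3 := by
  have e : Units.mk0 (((99328 : ℚ) / 10935)) (by norm_num) = Units.mk0 ((99328 : ℚ) / 10935) (by norm_num) := Units.ext (by norm_num)
  rw [Ne, e, mk_eq_splitDiscriminantClass_iff_of_even (n := 2) (by decide)]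
  have h := mul_not_mem_normUnitsSubgroup (mem_normUnitsSubgroup_of_sq_add_mul_sq (d := 3) (a := ((99328 : ℚ) / 54675)) (by norm_num) ((-16 : ℚ) / 45) ((304 : ℚ) / 405) (by norm_num))
    Summit.HodgeConjecture.Ring2WeilNormDescent.five_not_mem_norm_three
  rw [mk0_mul_mk0] at h
  norm_num at h
  exact h

/-- The same datum, CELL IDENTIFICATION: `[det H|_B] = [5]` in `ℚˣ/Nm(ℚ(√-3)ˣ)` — the census ROW KEY of `W4.3.5` (`a·5 = ((99328 : ℚ) / 2187) = (((-16 : ℚ) / 9))² + 3·(((304 : ℚ) / 81))²`).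
research route conditional on HC_CM; not a corollary; Q11.4-sentence-2 already refuted in dim ≥ 3. [cite: vanGeemen1994HodgeAV, Lemma 5.2 (3)] -/
theorem pwC3A5_c022_c122_c13_c13_q0_g61_mk_detH_eq_key :
    (QuotientGroup.mk (Units.mk0 (((99328 : ℚ) / 10935)) (by norm_num)) : weilNormResidueGroup 3) =
      QuotientGroup.mk (Units.mk0 (5 : ℚ) (by norm_num)) :=
  mk_eq_mk_of_mul_mem (by norm_num) (by norm_num)
    (mem_normUnitsSubgroup_of_sq_add_mul_sq _ ((-16 : ℚ) / 9) ((304 : ℚ) / 81) (by norm_num))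

/-- `C₆ × F₂₀`-cover `(0; c1:22,c1:4A,c4:4A)` (genus 41, Hurwitz dimension 0; engine `prodwin.py`, exact): the HIDDEN FACTOR `B = V^{H₁×Stab(0)}` of the `(λ⊗ρ)`-piece `P ~ B^{4}` (census row of `P`: `W16.3.1`) — an abelian FOURFOLD with `(2,2)` `ℚ(√-3)`-action, WEIL TYPE — has literal `det H|_B = 768/125`, `a = 768/125`, `T(a) = [3, 5]`: row `W4.3.5` (NON-split); `r₁ = dim_K H¹(C̃/G₂)_λ = 1`.
research route conditional on HC_CM; not a corollary; Q11.4-sentence-2 already refuted in dim ≥ 3. [cite: vanGeemen1994HodgeAV, (5.4.1)] -/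
theorem pwC6F20_c122_c14A_c44A_q0_g41_mk_detH_ne_split :
    (QuotientGroup.mk (Units.mk0 (((768 : ℚ) / 125)) (by norm_num)) : weilNormResidueGroup 3) ≠
      splitDiscriminantClass 2 3 := by
  have e : Units.mk0 (((768 : ℚ) / 125)) (by norm_num) = Units.mk0 ((768 : ℚ) / 125) (by norm_num) := Units.ext (by norm_num)
  rw [Ne, e, mk_eq_splitDiscriminantClass_iff_of_even (n := 2) (by decide)]
  have h := mul_not_mem_normUnitsSubgroup (mem_normUnitsSubgroup_of_sq_add_mul_sq (d := 3) (a := ((768 : ℚ) / 625)) (by norm_num) (0 : ℚ) ((16 : ℚ) / 25) (by norm_num))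
    Summit.HodgeConjecture.Ring2WeilNormDescent.five_not_mem_norm_three
  rw [mk0_mul_mk0] at h
  norm_num at h
  exact h

/-- The same datum, CELL IDENTIFICATION: `[det H|_B] = [5]` in `ℚˣ/Nm(ℚ(√-3)ˣ)` — the census ROW KEY of `W4.3.5` (`a·5 = ((768 : ℚ) / 25) = ((0 : ℚ))² + 3·(((16 : ℚ) / 5))²`).
research route conditional on HC_CM; not a corollary; Q11.4-sentence-2 already refuted in dim ≥ 3. [cite: vanGeemen1994HodgeAV, Lemma 5.2 (3)] -/
theorem pwC6F20_c122_c14A_c44A_q0_g41_mk_detH_eq_key :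
    (QuotientGroup.mk (Units.mk0 (((768 : ℚ) / 125)) (by norm_num)) : weilNormResidueGroup 3) =
      QuotientGroup.mk (Units.mk0 (5 : ℚ) (by norm_num)) :=
  mk_eq_mk_of_mul_mem (by norm_num) (by norm_num)
    (mem_normUnitsSubgroup_of_sq_add_mul_sq _ (0 : ℚ) ((16 : ℚ) / 5) (by norm_num))

/-- `C₆ × F₂₀`-cover `(0; c1:4A,c2:4A,c3:22)` (genus 21, Hurwitz dimension 0; engine `prodwin.py`, exact): the HIDDEN FACTOR `B = V^{H₁×Stab(0)}` of the `(λ⊗ρ)`-piece `P ~ B^{4}` (census row of `P`: `W8.3.1`) — an abelian SURFACE with `(1,1)` `ℚ(√-3)`-action, WEIL TYPE — has literal `det H|_B = -4/45`, `a = 4/45`, `T(a) = [3, 5]`: row `W2.3.5` (NON-split); `r₁ = dim_K H¹(C̃/G₂)_λ = 1`.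
research route conditional on HC_CM; not a corollary; Q11.4-sentence-2 already refuted in dim ≥ 3. [cite: vanGeemen1994HodgeAV, (5.4.1)] -/
theorem pwC6F20_c14A_c24A_c322_q0_g21_mk_detH_ne_split :
    (QuotientGroup.mk (Units.mk0 (((-4 : ℚ) / 45)) (by norm_num)) : weilNormResidueGroup 3) ≠
      splitDiscriminantClass 1 3 := by
  have e : Units.mk0 (((-4 : ℚ) / 45)) (by norm_num) = -(Units.mk0 ((4 : ℚ) / 45) (by norm_num)) := Units.ext (by norm_num)
  rw [Ne, e, mk_neg_eq_splitDiscriminantClass_iff_of_odd (n := 1) (by decide)]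
  have h := mul_not_mem_normUnitsSubgroup (mem_normUnitsSubgroup_of_sq_add_mul_sq (d := 3) (a := ((4 : ℚ) / 225)) (by norm_num) ((2 : ℚ) / 15) (0 : ℚ) (by norm_num))
    Summit.HodgeConjecture.Ring2WeilNormDescent.five_not_mem_norm_three
  rw [mk0_mul_mk0] at h
  norm_num at h
  exact h

/-- The same datum, CELL IDENTIFICATION: `[det H|_B] = [-5]` in `ℚˣ/Nm(ℚ(√-3)ˣ)` — the census ROW KEY of `W2.3.5` (`a·5 = ((4 : ℚ) / 9) = (((2 : ℚ) / 3))² + 3·((0 : ℚ))²`).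
research route conditional on HC_CM; not a corollary; Q11.4-sentence-2 already refuted in dim ≥ 3. [cite: vanGeemen1994HodgeAV, Lemma 5.2 (3)] -/
theorem pwC6F20_c14A_c24A_c322_q0_g21_mk_detH_eq_key :
    (QuotientGroup.mk (Units.mk0 (-(((4 : ℚ) / 45))) (neg_ne_zero.2 (by norm_num))) : weilNormResidueGroup 3) =
      QuotientGroup.mk (Units.mk0 (-(5 : ℚ)) (neg_ne_zero.2 (by norm_num))) :=
  mk_neg_eq_mk_neg_of_mul_mem (by norm_num) (by norm_num)
    (mem_normUnitsSubgroup_of_sq_add_mul_sq _ ((2 : ℚ) / 3) (0 : ℚ) (by norm_num))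

/-- `C₆ × F₂₀`-cover `(0; c1:4A,c2:4B,c3:5)` (genus 45, Hurwitz dimension 0; engine `prodwin.py`, exact): the HIDDEN FACTOR `B = V^{H₁×Stab(0)}` of the `(λ⊗ρ)`-piece `P ~ B^{4}` (census row of `P`: `W16.3.1`) — an abelian FOURFOLD with `(2,2)` `ℚ(√-3)`-action, WEIL TYPE — has literal `det H|_B = 1024/15`, `a = 1024/15`, `T(a) = [3, 5]`: row `W4.3.5` (NON-split); `r₁ = dim_K H¹(C̃/G₂)_λ = 1`.
research route conditional on HC_CM; not a corollary; Q11.4-sentence-2 already refuted in dim ≥ 3. [cite: vanGeemen1994HodgeAV, (5.4.1)] -/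
theorem pwC6F20_c14A_c24B_c35_q0_g45_mk_detH_ne_split :
    (QuotientGroup.mk (Units.mk0 (((1024 : ℚ) / 15)) (by norm_num)) : weilNormResidueGroup 3) ≠
      splitDiscriminantClass 2 3 := by
  have e : Units.mk0 (((1024 : ℚ) / 15)) (by norm_num) = Units.mk0 ((1024 : ℚ) / 15) (by norm_num) := Units.ext (by norm_num)
  rw [Ne, e, mk_eq_splitDiscriminantClass_iff_of_even (n := 2) (by decide)]
  have h := mul_not_mem_normUnitsSubgroup (mem_normUnitsSubgroup_of_sq_add_mul_sq (d := 3) (a := ((1024 : ℚ) / 75)) (by norm_num) (0 : ℚ) ((32 : ℚ) / 15) (by norm_num))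
    Summit.HodgeConjecture.Ring2WeilNormDescent.five_not_mem_norm_three
  rw [mk0_mul_mk0] at h
  norm_num at h
  exact h

/-- The same datum, CELL IDENTIFICATION: `[det H|_B] = [5]` in `ℚˣ/Nm(ℚ(√-3)ˣ)` — the census ROW KEY of `W4.3.5` (`a·5 = ((1024 : ℚ) / 3) = ((0 : ℚ))² + 3·(((32 : ℚ) / 3))²`).
research route conditional on HC_CM; not a corollary; Q11.4-sentence-2 already refuted in dim ≥ 3. [cite: vanGeemen1994HodgeAV, Lemma 5.2 (3)] -/
theorem pwC6F20_c14A_c24B_c35_q0_g45_mk_detH_eq_key :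
    (QuotientGroup.mk (Units.mk0 (((1024 : ℚ) / 15)) (by norm_num)) : weilNormResidueGroup 3) =
      QuotientGroup.mk (Units.mk0 (5 : ℚ) (by norm_num)) :=
  mk_eq_mk_of_mul_mem (by norm_num) (by norm_num)
    (mem_normUnitsSubgroup_of_sq_add_mul_sq _ (0 : ℚ) ((32 : ℚ) / 3) (by norm_num))

/-- `C₆ × F₂₀`-cover `(0; c0:22,c1:4A,c2:4A,c3:e)` (genus 51, Hurwitz dimension 1; engine `prodwin.py`, exact): the HIDDEN FACTOR `B = V^{H₁×Stab(0)}` of the `(λ⊗ρ)`-piece `P ~ B^{4}` (census row of `P`: `W24.3.1`) — an abelian SIXFOLD with `(3,3)` `ℚ(√-3)`-action, WEIL TYPE — has literal `det H|_B = -262144/45`, `a = 262144/45`, `T(a) = [3, 5]`: row `W6.3.5` (NON-split); `r₁ = dim_K H¹(C̃/G₂)_λ = 1`.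
research route conditional on HC_CM; not a corollary; Q11.4-sentence-2 already refuted in dim ≥ 3. [cite: vanGeemen1994HodgeAV, (5.4.1)] -/
theorem pwC6F20_c022_c14A_c24A_c3e_q0_g51_mk_detH_ne_split :
    (QuotientGroup.mk (Units.mk0 (((-262144 : ℚ) / 45)) (by norm_num)) : weilNormResidueGroup 3) ≠
      splitDiscriminantClass 3 3 := by
  have e : Units.mk0 (((-262144 : ℚ) / 45)) (by norm_num) = -(Units.mk0 ((262144 : ℚ) / 45) (by norm_num)) := Units.ext (by norm_num)
  rw [Ne, e, mk_neg_eq_splitDiscriminantClass_iff_of_odd (n := 3) (by decide)]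
  have h := mul_not_mem_normUnitsSubgroup (mem_normUnitsSubgroup_of_sq_add_mul_sq (d := 3) (a := ((262144 : ℚ) / 225)) (by norm_num) ((512 : ℚ) / 15) (0 : ℚ) (by norm_num))
    Summit.HodgeConjecture.Ring2WeilNormDescent.five_not_mem_norm_three
  rw [mk0_mul_mk0] at h
  norm_num at h
  exact h

/-- The same datum, CELL IDENTIFICATION: `[det H|_B] = [-5]` in `ℚˣ/Nm(ℚ(√-3)ˣ)` — the census ROW KEY of `W6.3.5` (`a·5 = ((262144 : ℚ) / 9) = (((512 : ℚ) / 3))² + 3·((0 : ℚ))²`).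
research route conditional on HC_CM; not a corollary; Q11.4-sentence-2 already refuted in dim ≥ 3. [cite: vanGeemen1994HodgeAV, Lemma 5.2 (3)] -/
theorem pwC6F20_c022_c14A_c24A_c3e_q0_g51_mk_detH_eq_key :
    (QuotientGroup.mk (Units.mk0 (-(((262144 : ℚ) / 45))) (neg_ne_zero.2 (by norm_num))) : weilNormResidueGroup 3) =
      QuotientGroup.mk (Units.mk0 (-(5 : ℚ)) (neg_ne_zero.2 (by norm_num))) :=
  mk_neg_eq_mk_neg_of_mul_mem (by norm_num) (by norm_num)
    (mem_normUnitsSubgroup_of_sq_add_mul_sq _ ((512 : ℚ) / 3) (0 : ℚ) (by norm_num))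

/-- `C₆ × F₂₀`-cover `(0; c0:22,c1:22,c1:4A,c4:4B)` (genus 71, Hurwitz dimension 1; engine `prodwin.py`, exact): the HIDDEN FACTOR `B = V^{H₁×Stab(0)}` of the `(λ⊗ρ)`-piece `P ~ B^{4}` (census row of `P`: `W24.3.1`) — an abelian SIXFOLD with `(3,3)` `ℚ(√-3)`-action, WEIL TYPE — has literal `det H|_B = -7168/135`, `a = 7168/135`, `T(a) = [3, 5]`: row `W6.3.5` (NON-split); `r₁ = dim_K H¹(C̃/G₂)_λ = 1`.
research route conditional on HC_CM; not a corollary; Q11.4-sentence-2 already refuted in dim ≥ 3. [cite: vanGeemen1994HodgeAV, (5.4.1)] -/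
theorem pwC6F20_c022_c122_c14A_c44B_q0_g71_mk_detH_ne_split :
    (QuotientGroup.mk (Units.mk0 (((-7168 : ℚ) / 135)) (by norm_num)) : weilNormResidueGroup 3) ≠
      splitDiscriminantClass 3 3 := by
  have e : Units.mk0 (((-7168 : ℚ) / 135)) (by norm_num) = -(Units.mk0 ((7168 : ℚ) / 135) (by norm_num)) := Units.ext (by norm_num)
  rw [Ne, e, mk_neg_eq_splitDiscriminantClass_iff_of_odd (n := 3) (by decide)]
  have h := mul_not_mem_normUnitsSubgroup (mem_normUnitsSubgroup_of_sq_add_mul_sq (d := 3) (a := ((7168 : ℚ) / 675)) (by norm_num) ((-16 : ℚ) / 15) ((16 : ℚ) / 9) (by norm_num))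
    Summit.HodgeConjecture.Ring2WeilNormDescent.five_not_mem_norm_three
  rw [mk0_mul_mk0] at h
  norm_num at h
  exact h

/-- The same datum, CELL IDENTIFICATION: `[det H|_B] = [-5]` in `ℚˣ/Nm(ℚ(√-3)ˣ)` — the census ROW KEY of `W6.3.5` (`a·5 = ((7168 : ℚ) / 27) = (((-16 : ℚ) / 3))² + 3·(((80 : ℚ) / 9))²`).
research route conditional on HC_CM; not a corollary; Q11.4-sentence-2 already refuted in dim ≥ 3. [cite: vanGeemen1994HodgeAV, Lemma 5.2 (3)] -/
theorem pwC6F20_c022_c122_c14A_c44B_q0_g71_mk_detH_eq_key :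
    (QuotientGroup.mk (Units.mk0 (-(((7168 : ℚ) / 135))) (neg_ne_zero.2 (by norm_num))) : weilNormResidueGroup 3) =
      QuotientGroup.mk (Units.mk0 (-(5 : ℚ)) (neg_ne_zero.2 (by norm_num))) :=
  mk_neg_eq_mk_neg_of_mul_mem (by norm_num) (by norm_num)
    (mem_normUnitsSubgroup_of_sq_add_mul_sq _ ((-16 : ℚ) / 3) ((80 : ℚ) / 9) (by norm_num))

/-- `C₄ × S₃`-cover `(0; c1:2,c1:3,c1:e,c2:e,c3:2)` (genus 21, Hurwitz dimension 2; engine `prodwin.py`, exact): the HIDDEN FACTOR `B = V^{H₁×Stab(0)}` of the `(λ⊗ρ)`-piece `P ~ B^{2}` (census row of `P`: `W12.1.1`) — an abelian SIXFOLD with `(3,3)` `ℚ(√-1)`-action, WEIL TYPE — has literal `det H|_B = -32/243`, `a = 32/243`, `T(a) = [2, 3]`: row `W6.1.3` (NON-split); `r₁ = dim_K H¹(C̃/G₂)_λ = 3`. THEOREM S6 (product-window law, census b04.13 (A)) predicts `T(a_B) = [2, 3]` from `r₁ = 3`, `r_H = 9` — CONFIRMED.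
research route conditional on HC_CM; not a corollary; Q11.4-sentence-2 already refuted in dim ≥ 3. [cite: vanGeemen1994HodgeAV, (5.4.1)] -/
theorem pwC4S3_c12_c13_c1e_c2e_c32_q0_g21_mk_detH_ne_split :
    (QuotientGroup.mk (Units.mk0 (((-32 : ℚ) / 243)) (by norm_num)) : weilNormResidueGroup 1) ≠
      splitDiscriminantClass 3 1 := by
  have e : Units.mk0 (((-32 : ℚ) / 243)) (by norm_num) = -(Units.mk0 ((32 : ℚ) / 243) (by norm_num)) := Units.ext (by norm_num)
  rw [Ne, e, mk_neg_eq_splitDiscriminantClass_iff_of_odd (n := 3) (by decide)]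
  have h := mul_not_mem_normUnitsSubgroup (mem_normUnitsSubgroup_of_sq_add_mul_sq (d := 1) (a := ((32 : ℚ) / 729)) (by norm_num) ((4 : ℚ) / 27) ((4 : ℚ) / 27) (by norm_num))
    Summit.HodgeConjecture.Ring2WeilNormDescent.three_not_mem_norm_one
  rw [mk0_mul_mk0] at h
  norm_num at h
  exact h

/-- The same datum, CELL IDENTIFICATION: `[det H|_B] = [-3]` in `ℚˣ/Nm(ℚ(√-1)ˣ)` — the census ROW KEY of `W6.1.3` (`a·3 = ((32 : ℚ) / 81) = (((4 : ℚ) / 9))² + 1·(((4 : ℚ) / 9))²`).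
research route conditional on HC_CM; not a corollary; Q11.4-sentence-2 already refuted in dim ≥ 3. [cite: vanGeemen1994HodgeAV, Lemma 5.2 (3)] -/
theorem pwC4S3_c12_c13_c1e_c2e_c32_q0_g21_mk_detH_eq_key :
    (QuotientGroup.mk (Units.mk0 (-(((32 : ℚ) / 243))) (neg_ne_zero.2 (by norm_num))) : weilNormResidueGroup 1) =
      QuotientGroup.mk (Units.mk0 (-(3 : ℚ)) (neg_ne_zero.2 (by norm_num))) :=
  mk_neg_eq_mk_neg_of_mul_mem (by norm_num) (by norm_num)
    (mem_normUnitsSubgroup_of_sq_add_mul_sq _ ((4 : ℚ) / 9) ((4 : ℚ) / 9) (by norm_num))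

/-- `C₄ × S₃`-cover `(0; c1:2,c1:2,c1:3,c2:e,c3:3)` (genus 23, Hurwitz dimension 2; engine `prodwin.py`, exact): the HIDDEN FACTOR `B = V^{H₁×Stab(0)}` of the `(λ⊗ρ)`-piece `P ~ B^{2}` (census row of `P`: `W12.1.1`) — an abelian SIXFOLD with `(3,3)` `ℚ(√-1)`-action, WEIL TYPE — has literal `det H|_B = -16/27`, `a = 16/27`, `T(a) = [2, 3]`: row `W6.1.3` (NON-split); `r₁ = dim_K H¹(C̃/G₂)_λ = 3`. THEOREM S6 (product-window law, census b04.13 (A)) predicts `T(a_B) = [2, 3]` from `r₁ = 3`, `r_H = 9` — CONFIRMED.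
research route conditional on HC_CM; not a corollary; Q11.4-sentence-2 already refuted in dim ≥ 3. [cite: vanGeemen1994HodgeAV, (5.4.1)] -/
theorem pwC4S3_c12_c12_c13_c2e_c33_q0_g23_mk_detH_ne_split :
    (QuotientGroup.mk (Units.mk0 (((-16 : ℚ) / 27)) (by norm_num)) : weilNormResidueGroup 1) ≠
      splitDiscriminantClass 3 1 := by
  have e : Units.mk0 (((-16 : ℚ) / 27)) (by norm_num) = -(Units.mk0 ((16 : ℚ) / 27) (by norm_num)) := Units.ext (by norm_num)
  rw [Ne, e, mk_neg_eq_splitDiscriminantClass_iff_of_odd (n := 3) (by decide)]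
  have h := mul_not_mem_normUnitsSubgroup (mem_normUnitsSubgroup_of_sq_add_mul_sq (d := 1) (a := ((16 : ℚ) / 81)) (by norm_num) ((4 : ℚ) / 9) (0 : ℚ) (by norm_num))
    Summit.HodgeConjecture.Ring2WeilNormDescent.three_not_mem_norm_one
  rw [mk0_mul_mk0] at h
  norm_num at h
  exact h

/-- The same datum, CELL IDENTIFICATION: `[det H|_B] = [-3]` in `ℚˣ/Nm(ℚ(√-1)ˣ)` — the census ROW KEY of `W6.1.3` (`a·3 = ((16 : ℚ) / 9) = (((4 : ℚ) / 3))² + 1·((0 : ℚ))²`).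
research route conditional on HC_CM; not a corollary; Q11.4-sentence-2 already refuted in dim ≥ 3. [cite: vanGeemen1994HodgeAV, Lemma 5.2 (3)] -/
theorem pwC4S3_c12_c12_c13_c2e_c33_q0_g23_mk_detH_eq_key :
    (QuotientGroup.mk (Units.mk0 (-(((16 : ℚ) / 27))) (neg_ne_zero.2 (by norm_num))) : weilNormResidueGroup 1) =
      QuotientGroup.mk (Units.mk0 (-(3 : ℚ)) (neg_ne_zero.2 (by norm_num))) :=
  mk_neg_eq_mk_neg_of_mul_mem (by norm_num) (by norm_num)
    (mem_normUnitsSubgroup_of_sq_add_mul_sq _ ((4 : ℚ) / 3) (0 : ℚ) (by norm_num))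

/-- `C₄ × S₃`-cover `(0; c1:2,c1:2,c1:e,c2:3,c3:e)` (genus 23, Hurwitz dimension 2; engine `prodwin.py`, exact): the HIDDEN FACTOR `B = V^{H₁×Stab(0)}` of the `(λ⊗ρ)`-piece `P ~ B^{2}` (census row of `P`: `W12.1.1`) — an abelian SIXFOLD with `(3,3)` `ℚ(√-1)`-action, WEIL TYPE — has literal `det H|_B = -64/27`, `a = 64/27`, `T(a) = [2, 3]`: row `W6.1.3` (NON-split); `r₁ = dim_K H¹(C̃/G₂)_λ = 3`. THEOREM S6 (product-window law, census b04.13 (A)) predicts `T(a_B) = [2, 3]` from `r₁ = 3`, `r_H = 9` — CONFIRMED.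
research route conditional on HC_CM; not a corollary; Q11.4-sentence-2 already refuted in dim ≥ 3. [cite: vanGeemen1994HodgeAV, (5.4.1)] -/
theorem pwC4S3_c12_c12_c1e_c23_c3e_q0_g23_mk_detH_ne_split :
    (QuotientGroup.mk (Units.mk0 (((-64 : ℚ) / 27)) (by norm_num)) : weilNormResidueGroup 1) ≠
      splitDiscriminantClass 3 1 := by
  have e : Units.mk0 (((-64 : ℚ) / 27)) (by norm_num) = -(Units.mk0 ((64 : ℚ) / 27) (by norm_num)) := Units.ext (by norm_num)
  rw [Ne, e, mk_neg_eq_splitDiscriminantClass_iff_of_odd (n := 3) (by decide)]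
  have h := mul_not_mem_normUnitsSubgroup (mem_normUnitsSubgroup_of_sq_add_mul_sq (d := 1) (a := ((64 : ℚ) / 81)) (by norm_num) ((8 : ℚ) / 9) (0 : ℚ) (by norm_num))
    Summit.HodgeConjecture.Ring2WeilNormDescent.three_not_mem_norm_one
  rw [mk0_mul_mk0] at h
  norm_num at h
  exact h

/-- The same datum, CELL IDENTIFICATION: `[det H|_B] = [-3]` in `ℚˣ/Nm(ℚ(√-1)ˣ)` — the census ROW KEY of `W6.1.3` (`a·3 = ((64 : ℚ) / 9) = (((8 : ℚ) / 3))² + 1·((0 : ℚ))²`).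
research route conditional on HC_CM; not a corollary; Q11.4-sentence-2 already refuted in dim ≥ 3. [cite: vanGeemen1994HodgeAV, Lemma 5.2 (3)] -/
theorem pwC4S3_c12_c12_c1e_c23_c3e_q0_g23_mk_detH_eq_key :
    (QuotientGroup.mk (Units.mk0 (-(((64 : ℚ) / 27))) (neg_ne_zero.2 (by norm_num))) : weilNormResidueGroup 1) =
      QuotientGroup.mk (Units.mk0 (-(3 : ℚ)) (neg_ne_zero.2 (by norm_num))) :=
  mk_neg_eq_mk_neg_of_mul_mem (by norm_num) (by norm_num)
    (mem_normUnitsSubgroup_of_sq_add_mul_sq _ ((8 : ℚ) / 3) (0 : ℚ) (by norm_num))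

/-- `C₄ × S₃`-cover `(0; c1:2,c1:3,c1:e,c2:3,c3:2)` (genus 25, Hurwitz dimension 2; engine `prodwin.py`, exact): the HIDDEN FACTOR `B = V^{H₁×Stab(0)}` of the `(λ⊗ρ)`-piece `P ~ B^{2}` (census row of `P`: `W12.1.1`) — an abelian SIXFOLD with `(3,3)` `ℚ(√-1)`-action, WEIL TYPE — has literal `det H|_B = -320/27`, `a = 320/27`, `T(a) = [2, 3]`: row `W6.1.3` (NON-split); `r₁ = dim_K H¹(C̃/G₂)_λ = 3`. THEOREM S6 (product-window law, census b04.13 (A)) predicts `T(a_B) = [2, 3]` from `r₁ = 3`, `r_H = 9` — CONFIRMED.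
research route conditional on HC_CM; not a corollary; Q11.4-sentence-2 already refuted in dim ≥ 3. [cite: vanGeemen1994HodgeAV, (5.4.1)] -/
theorem pwC4S3_c12_c13_c1e_c23_c32_q0_g25_mk_detH_ne_split :
    (QuotientGroup.mk (Units.mk0 (((-320 : ℚ) / 27)) (by norm_num)) : weilNormResidueGroup 1) ≠
      splitDiscriminantClass 3 1 := by
  have e : Units.mk0 (((-320 : ℚ) / 27)) (by norm_num) = -(Units.mk0 ((320 : ℚ) / 27) (by norm_num)) := Units.ext (by norm_num)
  rw [Ne, e, mk_neg_eq_splitDiscriminantClass_iff_of_odd (n := 3) (by decide)]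
  have h := mul_not_mem_normUnitsSubgroup (mem_normUnitsSubgroup_of_sq_add_mul_sq (d := 1) (a := ((320 : ℚ) / 81)) (by norm_num) ((16 : ℚ) / 9) ((8 : ℚ) / 9) (by norm_num))
    Summit.HodgeConjecture.Ring2WeilNormDescent.three_not_mem_norm_one
  rw [mk0_mul_mk0] at h
  norm_num at h
  exact h

/-- The same datum, CELL IDENTIFICATION: `[det H|_B] = [-3]` in `ℚˣ/Nm(ℚ(√-1)ˣ)` — the census ROW KEY of `W6.1.3` (`a·3 = ((320 : ℚ) / 9) = (((16 : ℚ) / 3))² + 1·(((8 : ℚ) / 3))²`).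
research route conditional on HC_CM; not a corollary; Q11.4-sentence-2 already refuted in dim ≥ 3. [cite: vanGeemen1994HodgeAV, Lemma 5.2 (3)] -/
theorem pwC4S3_c12_c13_c1e_c23_c32_q0_g25_mk_detH_eq_key :
    (QuotientGroup.mk (Units.mk0 (-(((320 : ℚ) / 27))) (neg_ne_zero.2 (by norm_num))) : weilNormResidueGroup 1) =
      QuotientGroup.mk (Units.mk0 (-(3 : ℚ)) (neg_ne_zero.2 (by norm_num))) :=
  mk_neg_eq_mk_neg_of_mul_mem (by norm_num) (by norm_num)
    (mem_normUnitsSubgroup_of_sq_add_mul_sq _ ((16 : ℚ) / 3) ((8 : ℚ) / 3) (by norm_num))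

end Summit.HodgeConjecture.HodgeConjecture.Ring2.WeilCoverage
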